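import Summits.AtomisticToContinuum.HydrodynamicLimit.Theses.TwoClocks
import Summits.AtomisticToContinuum.HydrodynamicLimit.Theses.OneFlightGossipEngine
import Summits.AtomisticToContinuum.HydrodynamicLimit.Theorems.ImplosionDichotomyHydroLimitInBandSignedInputs
import Summits.AtomisticToContinuum.HydrodynamicLimit.Theorems.ImplosionDichotomyHydroLimitProfilewiseBandKcwfQReduction
import Summits.AtomisticToContinuum.HydrodynamicLimit.Theorems.ImplosionDichotomyHydroLimitInBandActivityTailsOfTransfer
import Summits.AtomisticToContinuum.HydrodynamicLimit.Theorems.TwoClocksTransferEntropyClockFamilyNodesReduction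
import Summits.AtomisticToContinuum.HydrodynamicLimit.Theorems.OneFlightGossipEngineLocalClampedTransferLDAlongFamiliesSAxisNet
import Summits.AtomisticToContinuum.HydrodynamicLimit.Theorems.TwoClocksTransferEntropyClockTailRateDefs
import Summits.AtomisticToContinuum.HydrodynamicLimit.Theorems.TwoClocksTransferEntropyClockKineticWall
import HarnessLib

/-!
# Crux `TwoClocks.TransferEntropyClock` (stmt-AtomisticToContinuum-16625), line `tail-rate`, skeleton v16: the clock over the WEAKEST
# a-priori child — the super-exponential cubic tails SEET (item stmt-17701) — via the landed signed-band heart (support file, lead c6)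

`TransferEntropyClock := KineticWindowLDUniform → ClampedTransferWindowLD → TransferActivityTails → EnergyCurrentTails →
DiluteSelfConsistency → _root_.HydrodynamicLimit`.

The only use of Gaussian velocity tails in the clocks of this sub-problem is a super-exponential bound on the true-law CUBIC velocity tails
(the cubic channel of the energy row with the cut-off sent to infinity after the Grönwall, at a rate linear in the cut-off). That is the
existing item stmt-17701 `OneFlightGossipEngine.SuperExponentialEnergyTails`, strictly weaker than item 14415 `GaussianTails`
(`TransferEntropyClockRateNodes.seet_of_gaussianTails`, p142914). Since the OneFlightGossipEngine repair (rev 37) the heart's signed-band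
composition with SEET as tail input is landed (`HydroLimitInBandSignedBand.hydrodynamicLimit_of_signedInputs`, p148646: SEET → KCWF-Q →
LCTF → EAT → CAT → HydrodynamicLimit; DOCK-Q stmt-18054 is closed by it), KCWF-Q follows from the numeric kinetic rung `KCWUSharpPlus`
(`HydroLimitProfilewiseBandKcwfQ.kcwfQ_of_kcwuSharpPlus`), item 17691 from its single open stub `LCTSharp` (`LocalClampedTransferSketch.stub_sAxisNet`,
p147087), and EAT ∧ CAT from the crux's own antecedent `TwoClocks.TransferActivityTails`
(`HydroLimitInBandHeart.activityTails_of_transferActivityTails`). Hence, with no new plumbing: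

* `transferEntropyClock_of_seetItems : KCWUSharpPlus → LocalClampedTransferLDAlongFamilies (17691) → SuperExponentialEnergyTails (17701) →
  TwoClocks.TransferEntropyClock` — the `--glue-by` theorem of a split of 16625 into {KCWUSharpPlus, 17691, 17701} (c5's SPLIT-REQUEST v2
  Option A with child 3 weakened to SEET and the refuted child 4 = 17700 gone);
* `transferEntropyClock_of_seetStubs : KCWUSharpPlus → LCTSharp → SuperExponentialEnergyTails → TwoClocks.TransferEntropyClock` — the v16
  skeleton composition over the three registered stubs (16659's, 17691's, 17615's `stub_seet` = item 17701);
* `transferEntropyClock_of_wall_lct_seet` — the same with the kinetic stub replaced by the one kinetic wall `KineticWindowLDBoundsUniform` of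
  9282/14443/16659 (`TransferEntropyClockKineticWall.kcwuSharpPlus_of_boundsUniform`, p164091);
* `hydrodynamicLimit_of_seetStubs` — the sub-problem Statement from the three stubs and `TwoClocks.TransferActivityTails` alone.

References: H.-T. Yau, Lett. Math. Phys. 22 (1991) §2; B. Nachtergaele, H.-T. Yau, Comm. Math. Phys. 243 (2003) §2.3 and §7.2.
-/

noncomputable section

namespace Summit.AtomisticToContinuum.HydrodynamicLimit.Theorems.TransferEntropyClockSeetGlue

open Summit.AtomisticToContinuum.HydrodynamicLimit.Theses
open Summit.AtomisticToContinuum.HydrodynamicLimit.Theorems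
open Summit.AtomisticToContinuum.HydrodynamicLimit.Theorems.TransferEntropyClockTailRate (KCWUSharpPlus)
open Summit.AtomisticToContinuum.HydrodynamicLimit.Theorems.LocalClampedTransferSketch (LCTSharp)
open Summit.AtomisticToContinuum.HydrodynamicLimit.Theorems.KineticWindowGronwallPlusNode (KineticWindowLDBoundsUniform)

/-- **The Statement from the numeric kinetic rung, item 17691, item 17701 and the transfer-activity tails**: the landed signed-band
composition fed KCWF-Q from the rung and EAT ∧ CAT from `TwoClocks.TransferActivityTails` (the heart's energy-activity tails are the same term
as OneFlightGossipEngine's EAT). [cite: Yau1991, §2] -/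
theorem hydrodynamicLimit_of_seetItems (hK : KCWUSharpPlus) (hL : OneFlightGossipEngine.LocalClampedTransferLDAlongFamilies)
    (hS : OneFlightGossipEngine.SuperExponentialEnergyTails) (h₇ : TwoClocks.TransferActivityTails) : _root_.HydrodynamicLimit :=
  have hT := HydroLimitInBandHeart.activityTails_of_transferActivityTails
    (TransferEntropyClockFamilyNodes.transferActivityTails_iff_dock.mp h₇)
  HydroLimitInBandSignedBand.hydrodynamicLimit_of_signedInputs hS (HydroLimitProfilewiseBandKcwfQ.kcwfQ_of_kcwuSharpPlus hK) hL
    (show OneFlightGossipEngine.EnergyActivityTails from hT.2) hT.1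

/-- **The `--glue-by` theorem of the split of 16625 into {KCWUSharpPlus, item 17691, item 17701}**: the crux by name;
`KineticWindowLDUniform`, `ClampedTransferWindowLD`, `EnergyCurrentTails`, `DiluteSelfConsistency` idle, `TransferActivityTails` consumed.
[cite: Yau1991, §2] -/
theorem transferEntropyClock_of_seetItems :
    KCWUSharpPlus → OneFlightGossipEngine.LocalClampedTransferLDAlongFamilies → OneFlightGossipEngine.SuperExponentialEnergyTails →
      TwoClocks.TransferEntropyClock :=
  fun hK hL hS _ _ h₇ _ _ => hydrodynamicLimit_of_seetItems hK hL hS h₇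

/-- **The crux by name from the three registered stubs of skeleton v16** (16659's `KCWUSharpPlus`, 17691's `LCTSharp` through its landed
s-axis net, 17615's `stub_seet` = item 17701). [cite: Yau1991, §2] -/
theorem transferEntropyClock_of_seetStubs :
    TransferEntropyClockTailRate.KCWUSharpPlus → LocalClampedTransferSketch.LCTSharp → OneFlightGossipEngine.SuperExponentialEnergyTails → TwoClocks.TransferEntropyClock :=
  fun hK hLs hS => transferEntropyClock_of_seetItems hK (LocalClampedTransferSketch.stub_sAxisNet hLs) hS

/-- **The crux by name from the one kinetic wall, LCT♯ and SEET** (`kcwuSharpPlus_of_boundsUniform`, p164091). [cite: Yau1991, §2] -/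
theorem transferEntropyClock_of_wall_lct_seet (hU : KineticWindowLDBoundsUniform) (hLs : LCTSharp)
    (hS : OneFlightGossipEngine.SuperExponentialEnergyTails) : TwoClocks.TransferEntropyClock :=
  transferEntropyClock_of_seetStubs (TransferEntropyClockKineticWall.kcwuSharpPlus_of_boundsUniform hU) hLs hS

/-- **The restated clock over the three stubs**: the sub-problem Statement from the three registered stubs and `TwoClocks.TransferActivityTails`
alone (the type a restate of crux 16625 would take). [cite: Yau1991, §2] -/
theorem hydrodynamicLimit_of_seetStubs (hK : KCWUSharpPlus) (hLs : LCTSharp) (hS : OneFlightGossipEngine.SuperExponentialEnergyTails)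
    (h₇ : TwoClocks.TransferActivityTails) : _root_.HydrodynamicLimit :=
  hydrodynamicLimit_of_seetItems hK (LocalClampedTransferSketch.stub_sAxisNet hLs) hS h₇

end Summit.AtomisticToContinuum.HydrodynamicLimit.Theorems.TransferEntropyClockSeetGlue

end
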